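import Mathlib
import HarnessLib
import Summits.HubbardSuperconductivity.HubbardSuperconductivity.Theorems.KLProgrammeKLRegimeEnginePairTransferStep7AnalyticResolvedBudgetGridAll
import Summits.HubbardSuperconductivity.HubbardSuperconductivity.Theorems.KLProgrammeKLRegimeEnginePairTransferStep7AnalyticResolvedBudgetGridSplit

/-!
# Route `KLProgramme` — ENGINE child gen 8 (stmt-HubbardSuperconductivity-20437 `KLRegimeEngineV17F2`), class #5 rev 3 — THE ALL-Qm SPINE (cell STATUS (R247), regime (β) producer of record):
# producer `pairTransferStep7_of_analytic_resolved_budgetGridSplit_all` (guard-generic twin, RAW conclusion)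
# (cell gate-hubbard-kl, seat hubbard-kl-k3c1-p1 g16; CLASS5-RESOLVED-STEP.md §14 / KLTC-INDEX v12 §S)

WHY.  `pairTransferStep7_of_analytic_resolved_budgetGridSplit` (…Step7AnalyticResolvedBudgetGridSplit) with the pair-class guard replaced by an arbitrary antitone predicate `C L Qm n` in `hbase`/`hsucc`/`hexport` and the conclusion the RAW
relative family of the organiser `pairTransferStepAll_of_private` (Export5's family with `PairTransferRelAt` unfolded, guard `C`); same proof text over the `_all` parents.
Guard-generic plumbing over landed doors (token move `IsPairClassAt L Qm ↦ C L Qm`, `C` any ANTITONE guard; the all-Qm family is `C := fun _ _ _ => True`, the in-class family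
`C := fun L Qm n => IsPairClassAt L Qm n`); nothing about the model's sizes is asserted; nothing asserts (X).3, (c), K3 or superconductivity.  0 kit · 0 lit.
-/

noncomputable section

namespace Summit.HubbardSuperconductivity.HubbardSuperconductivity.Theorems.KLRegimeSplit

set_option linter.dupNamespace false -- summit = problem name (single-conjunct summit), D-0017

open Finset Matrix Set Literature.MathematicalPhysics.QuantumLattice Literature.Probability.LatticeModels GrassmannAlgebra
open Literature.MathematicalPhysics.QuantumLattice.FermiRG
open Summit.HubbardSuperconductivity.HubbardSuperconductivity.Theorems.KLProgrammeCooperResummation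
open Summit.HubbardSuperconductivity.HubbardSuperconductivity.Theorems.KLProgrammeLegKernels
open Summit.HubbardSuperconductivity.HubbardSuperconductivity.Theorems.TwoPointAssembly
open Summit.HubbardSuperconductivity.HubbardSuperconductivity.Theorems.DispersionFlow
open Summit.HubbardSuperconductivity.HubbardSuperconductivity.Theorems.KLRegimeWick
open Summit.HubbardSuperconductivity.HubbardSuperconductivity.Theorems.EngineV8

section ProducerAll

set_option maxHeartbeats 3200000 in -- long binder lists ×3 + the analytic bundle; two `ring` identities on the explicit budget number
/-- **`pairTransferStep7_of_analytic_resolved_budgetGridSplit_all`** (ALL-Qm spine: guard-generic twin of `pairTransferStep7_of_analytic_resolved_budgetGridSplit`, RAW conclusion) — row 85 with the ONE budget row split at share `φ = 1/2` into the owners' function-part row (B1)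
and the three SCALAR rows (B2) (B3) (B4) of the explicit number `TT` (module docstring). -/
theorem pairTransferStep7_of_analytic_resolved_budgetGridSplit_all (C : ∀ L : ℕ, TorusSite 2 L → ℕ → Prop) (hC : ∀ (L : ℕ) (Qm : TorusSite 2 L) (j n : ℕ), j ≤ n → C L Qm n → C L Qm j) {P : SplitConsts} {R : RenConsts} {Q₀ : EngConsts} {G Gth : GeoConsts} {r θ : ℝ} {u : EngConsts → ℝ → ℝ}
    (mA : ℝ → ℝ) (hR : R.WF2) (hCF : 0 ≤ Gth.CF) (hKl : 0 ≤ P.Klam) (hr : 0 ≤ r) (hθ0 : 0 ≤ θ) (hθ : θ ≤ 1 / 5)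
    (h0 : ∀ (U μ β : ℝ), μ ∈ klWindowC → FrameOK R U (nScales β) μ 0)
    (hmA : ∀ (Q : EngConsts) (cc U : ℝ), 0 < U → U ≤ u Q cc → 0 ≤ mA U ∧ mA U * ((2 : ℝ) ^ 10 * 15367) ≤ 1 / 3)
    {A2s : ℝ} {u2s : RenConsts → ℝ} (h2s : TwoShellFrameAreaAt A2s u2s) (hA2s : 0 ≤ A2s)
    -- the conv lemmas' regime side conditions, asked IN THE LOOP'S CONTEXT («hkit»; the band condition only for `1 ≤ n`; `U ≤ u2s R` is the package threshold's to grant)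
    (hkit : G.WF → ∀ Q : EngConsts, Q₀.IsRaiseOf Q →
      ∀ cc : ℝ, 0 < cc → cc ≤ klEngC₃6 P R →
        ∀ μ ∈ klWindowC, ∀ U : ℝ, 0 < U → U ≤ klEngU₀10 P R cc → U ≤ u Q cc →
          ∀ β : ℝ, klBetaMin ≤ β → β ≤ Real.exp (cc / U ^ 2) →
            ∀ (L M : ℕ) [NeZero L] [NeZero M], klEngL₄ P R β U ≤ L → klEngM₃ β U L ≤ M →
              ∀ n : ℕ, n + 1 ≤ nScales β + 1 → IsKLRegime U cc (-((n + 1 : ℕ) : ℤ)) →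
      U ≤ u2s R ∧ Real.pi / (4 * β) ≤ klScale klE0 (n + 1) ∧ (4 + 8 / 3 * R.Gfr 1 * U ^ 2) * (2 * Real.pi / L) ≤ klScale klE0 (n + 1) ∧
        (1 ≤ n → 2 * klScale klE0 n + (4 + 8 / 3 * R.Gfr 1 * U ^ 2) * (2 * Real.pi / L) ≤ klE0))
    (hbase : G.WF → ∀ Q : EngConsts, Q₀.IsRaiseOf Q →
      ∀ cc : ℝ, 0 < cc → cc ≤ klEngC₃6 P R →
        ∀ μ ∈ klWindowC, ∀ U : ℝ, 0 < U → U ≤ klEngU₀10 P R cc → U ≤ u Q cc →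
          ∀ β : ℝ, klBetaMin ≤ β → β ≤ Real.exp (cc / U ^ 2) →
            ∀ (L M : ℕ) [NeZero L] [NeZero M], klEngL₄ P R β U ≤ L → klEngM₃ β U L ≤ M →
              0 ≤ nScales β + 1 → IsKLRegime U cc (-((0 : ℕ) : ℤ)) →
                HistP klPredsV17F2 L M G P Q R β U μ 0 0 →
                  FrameOK R U (nScales β) μ (klFlowFrameU L M β U μ 0) →
                    (∀ j ≤ 0, LevelsUExportMixedAt L M (klCU2 P R Q₀) P β U μ j) →
      ∀ j j' : ℕ, 0 ≤ j' → j' ≤ j → j ≤ nScales β + 1 → ∀ Qm : TorusSite 2 L, C L Qm 0 →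
      -- BASE CLOSED at scale 0 (k3c1-p1 g14 rows 52/52b `klmg_memberAmplitude_sub_le_sq` / `klmf_baseData_of_scaleZero`; regime rows from the thresholds): the two a priori rows
      -- [class #1] and ONE scalar inequality of the depth `j′` (`klTransferC R` = k3c2-p1 g5's closed scale-0 transfer constant)
      (∀ x y, ‖klMemberArrayF L M β U μ 0 (softSymbolCompl L M β μ (klFlowFrameU L M β U μ 0) 0 j) Qm x y‖ ≤ mA U) ∧
        (∀ x y, ‖klMemberArrayF L M β U μ 0 (softSymbolCompl L M β μ (klFlowFrameU L M β U μ 0) 0 j') Qm x y‖ ≤ mA U) ∧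
        4 / 6047 * klIdxMass 0 j' * (klTransferC R * U ^ 2) + 4 * (mA U * mA U) * klIdxMass 0 j' ≤ θ * (r * ((P.Klam * U) ^ 2 * klIdxMass 0 j')))
    (hsucc : G.WF → ∀ Q : EngConsts, Q₀.IsRaiseOf Q →
      ∀ cc : ℝ, 0 < cc → cc ≤ klEngC₃6 P R →
        ∀ μ ∈ klWindowC, ∀ U : ℝ, 0 < U → U ≤ klEngU₀10 P R cc → U ≤ u Q cc →
          ∀ β : ℝ, klBetaMin ≤ β → β ≤ Real.exp (cc / U ^ 2) →
            ∀ (L M : ℕ) [NeZero L] [NeZero M], klEngL₄ P R β U ≤ L → klEngM₃ β U L ≤ M →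
              ∀ n : ℕ, n + 1 ≤ nScales β + 1 → IsKLRegime U cc (-((n + 1 : ℕ) : ℤ)) →
                HistP klPredsV17F2 L M G P Q R β U μ 0 (n + 1) →
                  FrameOK R U (nScales β) μ (klFlowFrameU L M β U μ (n + 1)) →
                    (∀ j ≤ n + 1, LevelsUExportMixedAt L M (klCU2 P R Q₀) P β U μ j) →
      (∀ Λ ∈ Icc (klScale klE0 (n + 1)) (klScale klE0 n), hubbardEffPartitionFnCT L M β U μ 0 (klFlowFrameU L M β U μ (n + 1)) Λ ≠ 0) ∧
      ∀ (A A' : ℕ → TorusSite 2 L → ℝ → Matrix (TorusSite 2 L) (TorusSite 2 L) ℂ) (b b' : ℕ → TorusSite 2 L → ℝ → TorusSite 2 L → ℂ)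
        (a : ℕ → ℕ → TorusSite 2 L → ℝ → TorusSite 2 L → ℂ) (ρ : ℕ → TorusSite 2 L → TorusSite 2 L → ℝ)
        (V : ℕ → ℝ → (Fin 4 → HubbardFieldIdx L M) → ℂ) (V6 : ℕ → ℝ → (Fin 6 → HubbardFieldIdx L M) → ℂ) (Sg : ℕ → ℝ → FreqMomentum L M → Fin 2 → ℂ) (Hd : ℕ → ℝ → (Fin 4 → HubbardFieldIdx L M) → ℂ) (Φ : ℕ → ℝ → FreqMomentum L M → ℝ) (Wd : ℝ →
                FreqMomentum L M → ℝ) (Br : ℕ → TorusSite 2 L → ℝ → TorusSite 2 L × MatsubaraIdx M → ℂ),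
        (A = fun j Qm t => Matrix.of fun k k' : TorusSite 2 L => if k ∈ klBall L μ 0 ∧ k' ∈ klBall L μ 0 then
      vertexFn L M β (gaussConv ℂ
        (softCovOf L M β μ (klFlowFrameU L M β U μ (n + 1)) (softSymbolCompl L M β μ (klFlowFrameU L M β U μ (n + 1)) (n + 1) j) + hubbardCovAboveCT L M β μ 0 (klFlowFrameU L M β U μ (n + 1)) (klScale klE0 (n + 1)) -
          hubbardCovAboveCT L M β μ 0 (klFlowFrameU L M β U μ (n + 1)) (klScale klE0 n + t * (klScale klE0 (n + 1) - klScale klE0 n)))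
        (hubbardEffectiveActionCT L M β U μ 0 (klFlowFrameU L M β U μ (n + 1)) (klScale klE0 n + t * (klScale klE0 (n + 1) - klScale klE0 n)))) 4
        ![(((omega0 M, k'), 0), 0), ((((omega0 M).rev, Qm - k'), 1), 0), ((((omega0 M).rev, Qm - k), 1), 1), (((omega0 M, k), 0), 1)]
      else 0) →
        (A' = fun j Qm t => Matrix.of fun k k' : TorusSite 2 L => if k ∈ klBall L μ 0 ∧ k' ∈ klBall L μ 0 then
      (klScale klE0 (n + 1) - klScale klE0 n) • -((2 : ℂ)⁻¹ * vertexFn L M β (gaussConv ℂ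
        (softCovOf L M β μ (klFlowFrameU L M β U μ (n + 1)) (softSymbolCompl L M β μ (klFlowFrameU L M β U μ (n + 1)) (n + 1) j) + hubbardCovAboveCT L M β μ 0 (klFlowFrameU L M β U μ (n + 1)) (klScale klE0 (n + 1)) -
          hubbardCovAboveCT L M β μ 0 (klFlowFrameU L M β U μ (n + 1)) (klScale klE0 n + t * (klScale klE0 (n + 1) - klScale klE0 n)))
        (grassmannDerivPairing ℂ
          (Matrix.of fun X Y : HubbardFieldIdx L M => deriv (fun Λ'' : ℝ => hubbardCovAboveCT L M β μ 0 (klFlowFrameU L M β U μ (n + 1)) Λ'' X Y)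
            (klScale klE0 n + t * (klScale klE0 (n + 1) - klScale klE0 n)))
          (hubbardEffectiveActionCT L M β U μ 0 (klFlowFrameU L M β U μ (n + 1)) (klScale klE0 n + t * (klScale klE0 (n + 1) - klScale klE0 n)))
          (hubbardEffectiveActionCT L M β U μ 0 (klFlowFrameU L M β U μ (n + 1)) (klScale klE0 n + t * (klScale klE0 (n + 1) - klScale klE0 n))))) 4
        ![(((omega0 M, k'), 0), 0), ((((omega0 M).rev, Qm - k'), 1), 0), ((((omega0 M).rev, Qm - k), 1), 1), (((omega0 M, k), 0), 1)])
      else 0) →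
        (b = fun j Qm t p => -((klBubbleMass L M β μ (klFlowFrameU L M β U μ (n + 1))
        (fun k => (softSymbolCompl L M β μ (klFlowFrameU L M β U μ (n + 1)) (n + 1) j) k + (hubbardCutoffWeightCT L M β μ (klFlowFrameU L M β U μ (n + 1)) (klScale klE0 (n + 1)) k -
          hubbardCutoffWeightCT L M β μ (klFlowFrameU L M β U μ (n + 1)) (klScale klE0 n + t * (klScale klE0 (n + 1) - klScale klE0 n)) k))
        (fun k => (softSymbolCompl L M β μ (klFlowFrameU L M β U μ (n + 1)) (n + 1) j) k + (hubbardCutoffWeightCT L M β μ (klFlowFrameU L M β U μ (n + 1)) (klScale klE0 (n + 1)) k -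
          hubbardCutoffWeightCT L M β μ (klFlowFrameU L M β U μ (n + 1)) (klScale klE0 n + t * (klScale klE0 (n + 1) - klScale klE0 n)) k)) Qm p : ℝ) : ℂ)) →
        (b' = fun j Qm t p => (((klScale klE0 (n + 1) - klScale klE0 n) *
        (klBubbleMass L M β μ (klFlowFrameU L M β U μ (n + 1))
            (fun k => deriv (fun Λ' => hubbardCutoffWeightCT L M β μ (klFlowFrameU L M β U μ (n + 1)) Λ' k) (klScale klE0 n + t * (klScale klE0 (n + 1) - klScale klE0 n)))
            (fun k => (softSymbolCompl L M β μ (klFlowFrameU L M β U μ (n + 1)) (n + 1) j) k + (hubbardCutoffWeightCT L M β μ (klFlowFrameU L M β U μ (n + 1)) (klScale klE0 (n + 1)) k -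
          hubbardCutoffWeightCT L M β μ (klFlowFrameU L M β U μ (n + 1)) (klScale klE0 n + t * (klScale klE0 (n + 1) - klScale klE0 n)) k)) Qm p +
          klBubbleMass L M β μ (klFlowFrameU L M β U μ (n + 1))
            (fun k => (softSymbolCompl L M β μ (klFlowFrameU L M β U μ (n + 1)) (n + 1) j) k + (hubbardCutoffWeightCT L M β μ (klFlowFrameU L M β U μ (n + 1)) (klScale klE0 (n + 1)) k -
          hubbardCutoffWeightCT L M β μ (klFlowFrameU L M β U μ (n + 1)) (klScale klE0 n + t * (klScale klE0 (n + 1) - klScale klE0 n)) k))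
            (fun k => deriv (fun Λ' => hubbardCutoffWeightCT L M β μ (klFlowFrameU L M β U μ (n + 1)) Λ' k) (klScale klE0 n + t * (klScale klE0 (n + 1) - klScale klE0 n)))
            Qm p) : ℝ) : ℂ)) →
        (a = fun j j' Qm t p => (b j Qm t p - b j' Qm t p) +
      (-(((klTransferWeight L M β μ (klFlowFrameU L M β U μ (n + 1)) (n + 1) (softSymbolCompl L M β μ (klFlowFrameU L M β U μ (n + 1)) (n + 1) j) Qm p -
          klTransferWeight L M β μ (klFlowFrameU L M β U μ (n + 1)) (n + 1) (softSymbolCompl L M β μ (klFlowFrameU L M β U μ (n + 1)) (n + 1) j') Qm p : ℝ)) : ℂ) -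
        (b j Qm 1 p - b j' Qm 1 p))) →
        (ρ = fun j Qm c => klRungProfile L M β μ (klFlowFrameU L M β U μ (n + 1)) n (softSymbolCompl L M β μ (klFlowFrameU L M β U μ (n + 1)) (n + 1) j) Qm c) →
        (V = fun j t X => vertexFn L M β (gaussConv ℂ (softCovOf L M β μ (klFlowFrameU L M β U μ (n + 1)) (softSymbolCompl L M β μ (klFlowFrameU L M β U μ (n + 1)) (n + 1) j) + hubbardCovAboveCT L M β μ 0 (klFlowFrameU L M β U μ (n + 1)) (klScale
                klE0 (n + 1)) - hubbardCovAboveCT L M β μ 0 (klFlowFrameU L M β U μ (n + 1)) (klScale klE0 n + t * (klScale klE0 (n + 1) - klScale klE0 n))) (hubbardEffectiveActionCT L M β U μ 0 (klFlowFrameU L M β U μ (n + 1)) (klScale klE0 n + t *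
                (klScale klE0 (n + 1) - klScale klE0 n)))) 4 X) →
        (V6 = fun j t X => vertexFn L M β (gaussConv ℂ (softCovOf L M β μ (klFlowFrameU L M β U μ (n + 1)) (softSymbolCompl L M β μ (klFlowFrameU L M β U μ (n + 1)) (n + 1) j) + hubbardCovAboveCT L M β μ 0 (klFlowFrameU L M β U μ (n + 1)) (klScale
                klE0 (n + 1)) - hubbardCovAboveCT L M β μ 0 (klFlowFrameU L M β U μ (n + 1)) (klScale klE0 n + t * (klScale klE0 (n + 1) - klScale klE0 n))) (hubbardEffectiveActionCT L M β U μ 0 (klFlowFrameU L M β U μ (n + 1)) (klScale klE0 n + t *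
                (klScale klE0 (n + 1) - klScale klE0 n)))) 6 X) →
        (Sg = fun j t p σ => selfEnergy L M β (gaussConv ℂ (softCovOf L M β μ (klFlowFrameU L M β U μ (n + 1)) (softSymbolCompl L M β μ (klFlowFrameU L M β U μ (n + 1)) (n + 1) j) + hubbardCovAboveCT L M β μ 0 (klFlowFrameU L M β U μ (n + 1))
                (klScale klE0 (n + 1)) - hubbardCovAboveCT L M β μ 0 (klFlowFrameU L M β U μ (n + 1)) (klScale klE0 n + t * (klScale klE0 (n + 1) - klScale klE0 n))) (hubbardEffectiveActionCT L M β U μ 0 (klFlowFrameU L M β U μ (n + 1)) (klScale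
                klE0 n + t * (klScale klE0 (n + 1) - klScale klE0 n)))) p σ) →
        (Hd = fun j t X => vertexFn L M β (dblFold ℂ (grassmannLaplacian ℂ (crossCov ℂ (Matrix.of fun X Y : HubbardFieldIdx L M => deriv (fun Λ' : ℝ => hubbardCovAboveCT L M β μ 0 (klFlowFrameU L M β U μ (n + 1)) Λ' X Y) (klScale klE0 n + t *
                (klScale klE0 (n + 1) - klScale klE0 n)))) ((gaussConv ℂ (crossCov ℂ (softCovOf L M β μ (klFlowFrameU L M β U μ (n + 1)) (softSymbolCompl L M β μ (klFlowFrameU L M β U μ (n + 1)) (n + 1) j) + hubbardCovAboveCT L M β μ 0 (klFlowFrameU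
                L M β U μ (n + 1)) (klScale klE0 (n + 1)) - hubbardCovAboveCT L M β μ 0 (klFlowFrameU L M β U μ (n + 1)) (klScale klE0 n + t * (klScale klE0 (n + 1) - klScale klE0 n)))) - grassmannLaplacian ℂ (crossCov ℂ (softCovOf L M β μ
                (klFlowFrameU L M β U μ (n + 1)) (softSymbolCompl L M β μ (klFlowFrameU L M β U μ (n + 1)) (n + 1) j) + hubbardCovAboveCT L M β μ 0 (klFlowFrameU L M β U μ (n + 1)) (klScale klE0 (n + 1)) - hubbardCovAboveCT L M β μ 0 (klFlowFrameU L
                M β U μ (n + 1)) (klScale klE0 n + t * (klScale klE0 (n + 1) - klScale klE0 n))))) (dblCopy ℂ 0 (gaussConv ℂ (softCovOf L M β μ (klFlowFrameU L M β U μ (n + 1)) (softSymbolCompl L M β μ (klFlowFrameU L M β U μ (n + 1)) (n + 1) j) +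
                hubbardCovAboveCT L M β μ 0 (klFlowFrameU L M β U μ (n + 1)) (klScale klE0 (n + 1)) - hubbardCovAboveCT L M β μ 0 (klFlowFrameU L M β U μ (n + 1)) (klScale klE0 n + t * (klScale klE0 (n + 1) - klScale klE0 n)))
                (hubbardEffectiveActionCT L M β U μ 0 (klFlowFrameU L M β U μ (n + 1)) (klScale klE0 n + t * (klScale klE0 (n + 1) - klScale klE0 n)))) * dblCopy ℂ 1 (gaussConv ℂ (softCovOf L M β μ (klFlowFrameU L M β U μ (n + 1)) (softSymbolCompl L
                M β μ (klFlowFrameU L M β U μ (n + 1)) (n + 1) j) + hubbardCovAboveCT L M β μ 0 (klFlowFrameU L M β U μ (n + 1)) (klScale klE0 (n + 1)) - hubbardCovAboveCT L M β μ 0 (klFlowFrameU L M β U μ (n + 1)) (klScale klE0 n + t * (klScale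
                klE0 (n + 1) - klScale klE0 n))) (hubbardEffectiveActionCT L M β U μ 0 (klFlowFrameU L M β U μ (n + 1)) (klScale klE0 n + t * (klScale klE0 (n + 1) - klScale klE0 n)))))))) 4 X) →
        (Φ = fun j t k => (softSymbolCompl L M β μ (klFlowFrameU L M β U μ (n + 1)) (n + 1) j) k + (hubbardCutoffWeightCT L M β μ (klFlowFrameU L M β U μ (n + 1)) (klScale klE0 (n + 1)) k - hubbardCutoffWeightCT L M β μ (klFlowFrameU L M β U μ (n +
                1)) (klScale klE0 n + t * (klScale klE0 (n + 1) - klScale klE0 n)) k)) →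
        (Wd = fun t k => deriv (fun Λ' : ℝ => hubbardCutoffWeightCT L M β μ (klFlowFrameU L M β U μ (n + 1)) Λ' k) (klScale klE0 n + t * (klScale klE0 (n + 1) - klScale klE0 n))) →
        (Br = fun j Qm t z => -(((((β * (L : ℝ) ^ 2 : ℝ) : ℂ)))⁻¹ * propCT L M β μ (klFlowFrameU L M β U μ (n + 1)) (z.2, z.1) * propCT L M β μ (klFlowFrameU L M β U μ (n + 1)) (z.2.rev, Qm - z.1)) *
      ((((klScale klE0 (n + 1) - klScale klE0 n) * (-Wd t (z.2, z.1) * Φ j t (z.2.rev, Qm - z.1) - Φ j t (z.2, z.1) * Wd t (z.2.rev, Qm - z.1))) : ℝ) : ℂ)) →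
      ∀ j j' : ℕ, n + 1 ≤ j' → j' ≤ j → j ≤ nScales β + 1 → ∀ Qm : TorusSite 2 L, C L Qm (n + 1) →
      ∃ (ηr η₁ η₂ R₀ Φ : TorusSite 2 L → TorusSite 2 L → ℝ) (d : TorusSite 2 L → ℝ) (M4 M6 M2 η4 η6 η2 : ℝ) (Ish Iw : ℕ)
        (RH₁ RH₂ Rhd RL₁ RL₂ Rl₁ Rl₂ : TorusSite 2 L → TorusSite 2 L → ℝ) (Ng : ℕ → ℝ),
        (∀ t ∈ Icc (0 : ℝ) 1, ∀ x y, ‖A j Qm t x y‖ ≤ mA U) ∧ (∀ t ∈ Icc (0 : ℝ) 1, ∀ x y, ‖A j' Qm t x y‖ ≤ mA U) ∧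
        -- class-#1 kernel inputs IN GRID-NORMS CURRENCY (rows 48/51): the pinned GRID kernel norms `Ng` of `Gg(t) = effAction (SᵀC^K_(Λ(t))S)(V_N + 𝒩_(K,N))` and the six binomial numbers
        -- they produce (γ := √6047, κD := √(Λ_(n+1)·klIdxMass (n+1) j′) discharged); `M4 M6 M2 η4 η6 η2` are the names the `Ran` row uses
        (∀ m', 0 ≤ Ng m') ∧
        (∀ t ∈ Icc (0 : ℝ) 1, ∀ m' (i : Fin (2 * m')) (w : GridLeg (GridPoint L (2 * (2 * M)))),
          ∑ Y ∈ univ.filter (fun Y : Fin (2 * m') → GridLeg (GridPoint L (2 * (2 * M))) => Y i = w),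
            ‖kernel ℂ (effAction ℂ ((hubbardGridSub L M β (2 * (2 * M))).transpose * hubbardCovAboveCT L M β μ 0 (klFlowFrameU L M β U μ (n + 1)) (klScale klE0 n + t * (klScale klE0 (n + 1) - klScale klE0 n)) * hubbardGridSub L M β (2 * (2 * M)))
              (hubbardGridInteraction L (2 * (2 * M)) β U + hubbardGridCounterQuadratic L (2 * (2 * M)) β (klFlowFrameU L M β U μ (n + 1)))) (2 * m') Y‖ ≤ Ng m') ∧
        (((2 * 2).factorial : ℝ) / (β * (L : ℝ) ^ 2) * (Fintype.card (GridLeg (GridPoint L (2 * (2 * M)))) *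
          ∑ m' ∈ range (Fintype.card (GridLeg (GridPoint L (2 * (2 * M)))) / 2 + 1), if 2 ≤ m' then ((2 * m').choose (2 * 2) : ℝ) * Real.sqrt 6047 ^ (2 * m' - 2 * 2) * Ng m' else 0) ≤ M4) ∧
        (((2 * 3).factorial : ℝ) / (β * (L : ℝ) ^ 2) * (Fintype.card (GridLeg (GridPoint L (2 * (2 * M)))) *
          ∑ m' ∈ range (Fintype.card (GridLeg (GridPoint L (2 * (2 * M)))) / 2 + 1), if 3 ≤ m' then ((2 * m').choose (2 * 3) : ℝ) * Real.sqrt 6047 ^ (2 * m' - 2 * 3) * Ng m' else 0) ≤ M6) ∧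
        (((2 * 1).factorial : ℝ) / (β * (L : ℝ) ^ 2) * (Fintype.card (GridLeg (GridPoint L (2 * (2 * M)))) *
          ∑ m' ∈ range (Fintype.card (GridLeg (GridPoint L (2 * (2 * M)))) / 2 + 1), if 1 ≤ m' then ((2 * m').choose (2 * 1) : ℝ) * Real.sqrt 6047 ^ (2 * m' - 2 * 1) * Ng m' else 0) ≤ M2) ∧
        (((2 * 2).factorial : ℝ) / (β * (L : ℝ) ^ 2) * (Fintype.card (GridLeg (GridPoint L (2 * (2 * M)))) *
          ∑ m' ∈ range (Fintype.card (GridLeg (GridPoint L (2 * (2 * M)))) / 2 + 1), if 2 < m' then ((2 * m').choose (2 * 2) : ℝ) * Real.sqrt (klScale klE0 (n + 1) * klIdxMass (n + 1) j') ^ (2 * m' - 2 * 2) * (∑ m'' ∈ range (Fintype.card (GridLeg (GridPoint L (2 * (2 * M)))) / 2 + 1), if m' ≤ m'' then ((2 * m'').choose (2 * m') : ℝ) * Real.sqrt 6047 ^ (2 * m'' - 2 * m') * Ng m'' else 0) else 0) ≤ η4) ∧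
        (((2 * 3).factorial : ℝ) / (β * (L : ℝ) ^ 2) * (Fintype.card (GridLeg (GridPoint L (2 * (2 * M)))) *
          ∑ m' ∈ range (Fintype.card (GridLeg (GridPoint L (2 * (2 * M)))) / 2 + 1), if 3 < m' then ((2 * m').choose (2 * 3) : ℝ) * Real.sqrt (klScale klE0 (n + 1) * klIdxMass (n + 1) j') ^ (2 * m' - 2 * 3) * (∑ m'' ∈ range (Fintype.card (GridLeg (GridPoint L (2 * (2 * M)))) / 2 + 1), if m' ≤ m'' then ((2 * m'').choose (2 * m') : ℝ) * Real.sqrt 6047 ^ (2 * m'' - 2 * m') * Ng m'' else 0) else 0) ≤ η6) ∧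
        (((2 * 1).factorial : ℝ) / (β * (L : ℝ) ^ 2) * (Fintype.card (GridLeg (GridPoint L (2 * (2 * M)))) *
          ∑ m' ∈ range (Fintype.card (GridLeg (GridPoint L (2 * (2 * M)))) / 2 + 1), if 1 < m' then ((2 * m').choose (2 * 1) : ℝ) * Real.sqrt (klScale klE0 (n + 1) * klIdxMass (n + 1) j') ^ (2 * m' - 2 * 1) * (∑ m'' ∈ range (Fintype.card (GridLeg (GridPoint L (2 * (2 * M)))) / 2 + 1), if m' ≤ m'' then ((2 * m'').choose (2 * m') : ℝ) * Real.sqrt 6047 ^ (2 * m'' - 2 * m') * Ng m'' else 0) else 0) ≤ η2) ∧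
        (∀ t ∈ Icc (0 : ℝ) 1, ∀ x y : TorusSite 2 L, ‖Hd j t ![(((omega0 M, y), 0), 0), ((((omega0 M).rev, Qm - y), 1), 0), ((((omega0 M).rev, Qm - x), 1), 1), (((omega0 M, x), 0), 1)]‖ ≤ RH₁ x y) ∧ (∀ t ∈ Icc (0 : ℝ) 1, ∀ x y : TorusSite 2 L, ‖Hd j' t
                ![(((omega0 M, y), 0), 0), ((((omega0 M).rev, Qm - y), 1), 0), ((((omega0 M).rev, Qm - x), 1), 1), (((omega0 M, x), 0), 1)]‖ ≤ RH₂ x y) ∧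
        (∀ t ∈ Icc (0 : ℝ) 1, ∀ x y : TorusSite 2 L, ‖Hd j t ![(((omega0 M, y), 0), 0), ((((omega0 M).rev, Qm - y), 1), 0), ((((omega0 M).rev, Qm - x), 1), 1), (((omega0 M, x), 0), 1)] - Hd j' t ![(((omega0 M, y), 0), 0), ((((omega0 M).rev, Qm - y),
                1), 0), ((((omega0 M).rev, Qm - x), 1), 1), (((omega0 M, x), 0), 1)]‖ ≤ Rhd x y) ∧
        (∀ t ∈ Icc (0 : ℝ) 1, ∀ x y : TorusSite 2 L, ‖∑ z : TorusSite 2 L × MatsubaraIdx M, Br j Qm t z *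
          ((if z.1 ∈ klBall L μ 0 then
              V j t ![(((omega0 M, z.1), 0), 0), ((((omega0 M).rev, Qm - z.1), 1), 0), ((((omega0 M).rev, Qm - x), 1), 1), (((omega0 M, x), 0), 1)] *
                V j t ![(((omega0 M, y), 0), 0), ((((omega0 M).rev, Qm - y), 1), 0), ((((omega0 M).rev, Qm - z.1), 1), 1), (((omega0 M, z.1), 0), 1)]
            else 0) -
            V j t ![(((z.2, z.1), 0), 0), (((z.2.rev, Qm - z.1), 1), 0), ((((omega0 M).rev, Qm - x), 1), 1), (((omega0 M, x), 0), 1)] *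
              V j t ![(((omega0 M, y), 0), 0), ((((omega0 M).rev, Qm - y), 1), 0), (((z.2.rev, Qm - z.1), 1), 1), (((z.2, z.1), 0), 1)])‖ ≤ RL₁ x y) ∧
        (∀ t ∈ Icc (0 : ℝ) 1, ∀ x y : TorusSite 2 L, ‖∑ z : TorusSite 2 L × MatsubaraIdx M, Br j' Qm t z *
          ((if z.1 ∈ klBall L μ 0 then
              V j' t ![(((omega0 M, z.1), 0), 0), ((((omega0 M).rev, Qm - z.1), 1), 0), ((((omega0 M).rev, Qm - x), 1), 1), (((omega0 M, x), 0), 1)] *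
                V j' t ![(((omega0 M, y), 0), 0), ((((omega0 M).rev, Qm - y), 1), 0), ((((omega0 M).rev, Qm - z.1), 1), 1), (((omega0 M, z.1), 0), 1)]
            else 0) -
            V j' t ![(((z.2, z.1), 0), 0), (((z.2.rev, Qm - z.1), 1), 0), ((((omega0 M).rev, Qm - x), 1), 1), (((omega0 M, x), 0), 1)] *
              V j' t ![(((omega0 M, y), 0), 0), ((((omega0 M).rev, Qm - y), 1), 0), (((z.2.rev, Qm - z.1), 1), 1), (((z.2, z.1), 0), 1)])‖ ≤ RL₂ x y) ∧
        (∀ t ∈ Icc (0 : ℝ) 1, ∀ x y : TorusSite 2 L, ‖∑ z : TorusSite 2 L × MatsubaraIdx M, (fun z : TorusSite 2 L × MatsubaraIdx M => -(((((β * (L : ℝ) ^ 2 : ℝ) : ℂ)))⁻¹ * propCT L M β μ (klFlowFrameU L M β U μ (n + 1)) (z.2, z.1) * propCT L M β μ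
                (klFlowFrameU L M β U μ (n + 1)) (z.2.rev, Qm - z.1)) * ((((klScale klE0 (n + 1) - klScale klE0 n) * (-Wd t (z.2, z.1) * ((softSymbolCompl L M β μ (klFlowFrameU L M β U μ (n + 1)) (n + 1) j) (z.2.rev, Qm - z.1) - (softSymbolCompl L M
                β μ (klFlowFrameU L M β U μ (n + 1)) (n + 1) j') (z.2.rev, Qm - z.1)) - ((softSymbolCompl L M β μ (klFlowFrameU L M β U μ (n + 1)) (n + 1) j) (z.2, z.1) - (softSymbolCompl L M β μ (klFlowFrameU L M β U μ (n + 1)) (n + 1) j') (z.2,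
                z.1)) * Wd t (z.2.rev, Qm - z.1))) : ℝ) : ℂ)) z *
          ((if z.1 ∈ klBall L μ 0 then
              V j t ![(((omega0 M, z.1), 0), 0), ((((omega0 M).rev, Qm - z.1), 1), 0), ((((omega0 M).rev, Qm - x), 1), 1), (((omega0 M, x), 0), 1)] *
                V j t ![(((omega0 M, y), 0), 0), ((((omega0 M).rev, Qm - y), 1), 0), ((((omega0 M).rev, Qm - z.1), 1), 1), (((omega0 M, z.1), 0), 1)]
            else 0) -
            V j t ![(((z.2, z.1), 0), 0), (((z.2.rev, Qm - z.1), 1), 0), ((((omega0 M).rev, Qm - x), 1), 1), (((omega0 M, x), 0), 1)] *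
              V j t ![(((omega0 M, y), 0), 0), ((((omega0 M).rev, Qm - y), 1), 0), (((z.2.rev, Qm - z.1), 1), 1), (((z.2, z.1), 0), 1)])‖ ≤ Rl₁ x y) ∧
        (∀ t ∈ Icc (0 : ℝ) 1, ∀ x y : TorusSite 2 L, ‖∑ z : TorusSite 2 L × MatsubaraIdx M, Br j' Qm t z *
          (((if z.1 ∈ klBall L μ 0 then
              V j t ![(((omega0 M, z.1), 0), 0), ((((omega0 M).rev, Qm - z.1), 1), 0), ((((omega0 M).rev, Qm - x), 1), 1), (((omega0 M, x), 0), 1)] *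
                V j t ![(((omega0 M, y), 0), 0), ((((omega0 M).rev, Qm - y), 1), 0), ((((omega0 M).rev, Qm - z.1), 1), 1), (((omega0 M, z.1), 0), 1)]
            else 0) -
            V j t ![(((z.2, z.1), 0), 0), (((z.2.rev, Qm - z.1), 1), 0), ((((omega0 M).rev, Qm - x), 1), 1), (((omega0 M, x), 0), 1)] *
              V j t ![(((omega0 M, y), 0), 0), ((((omega0 M).rev, Qm - y), 1), 0), (((z.2.rev, Qm - z.1), 1), 1), (((z.2, z.1), 0), 1)]) -
            ((if z.1 ∈ klBall L μ 0 then
              V j' t ![(((omega0 M, z.1), 0), 0), ((((omega0 M).rev, Qm - z.1), 1), 0), ((((omega0 M).rev, Qm - x), 1), 1), (((omega0 M, x), 0), 1)] *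
                V j' t ![(((omega0 M, y), 0), 0), ((((omega0 M).rev, Qm - y), 1), 0), ((((omega0 M).rev, Qm - z.1), 1), 1), (((omega0 M, z.1), 0), 1)]
            else 0) -
            V j' t ![(((z.2, z.1), 0), 0), (((z.2.rev, Qm - z.1), 1), 0), ((((omega0 M).rev, Qm - x), 1), 1), (((omega0 M, x), 0), 1)] *
              V j' t ![(((omega0 M, y), 0), 0), ((((omega0 M).rev, Qm - y), 1), 0), (((z.2.rev, Qm - z.1), 1), 1), (((z.2, z.1), 0), 1)]))‖ ≤ Rl₂ x y) ∧
        (∀ x y, ‖klMemberArrayF L M β U μ n (softSymbolCompl L M β μ (klFlowFrameU L M β U μ n) n j) Qm x y‖ ≤ mA U) ∧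
        -- (F)(i) [k3c2-p2]: majorants of the FRAME SHIFT `K_n → K_(n+1)` of the history members / relative weight (model objects)
        (∀ x y, ‖(((Matrix.of fun k k' : TorusSite 2 L => if k ∈ klBall L μ 0 ∧ k' ∈ klBall L μ 0 then
        klCovSmearedPairAmplitude L M β U μ (klFlowFrameU L M β U μ (n + 1)) n (softCovOf L M β μ (klFlowFrameU L M β U μ (n + 1)) (softSymbolCompl L M β μ (klFlowFrameU L M β U μ (n + 1)) n j)) Qm k k' else 0) -
        klMemberArrayF L M β U μ n (softSymbolCompl L M β μ (klFlowFrameU L M β U μ n) n j) Qm) -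
          ((Matrix.of fun k k' : TorusSite 2 L => if k ∈ klBall L μ 0 ∧ k' ∈ klBall L μ 0 then
        klCovSmearedPairAmplitude L M β U μ (klFlowFrameU L M β U μ (n + 1)) n (softCovOf L M β μ (klFlowFrameU L M β U μ (n + 1)) (softSymbolCompl L M β μ (klFlowFrameU L M β U μ (n + 1)) n j')) Qm k k' else 0) -
        klMemberArrayF L M β U μ n (softSymbolCompl L M β μ (klFlowFrameU L M β U μ n) n j') Qm)) x y‖ ≤ ηr x y) ∧
        (∀ x y, ‖((Matrix.of fun k k' : TorusSite 2 L => if k ∈ klBall L μ 0 ∧ k' ∈ klBall L μ 0 then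
        klCovSmearedPairAmplitude L M β U μ (klFlowFrameU L M β U μ (n + 1)) n (softCovOf L M β μ (klFlowFrameU L M β U μ (n + 1)) (softSymbolCompl L M β μ (klFlowFrameU L M β U μ (n + 1)) n j)) Qm k k' else 0) -
        klMemberArrayF L M β U μ n (softSymbolCompl L M β μ (klFlowFrameU L M β U μ n) n j) Qm) x y‖ ≤ η₁ x y) ∧
        (∀ x y, ‖((Matrix.of fun k k' : TorusSite 2 L => if k ∈ klBall L μ 0 ∧ k' ∈ klBall L μ 0 then
        klCovSmearedPairAmplitude L M β U μ (klFlowFrameU L M β U μ (n + 1)) n (softCovOf L M β μ (klFlowFrameU L M β U μ (n + 1)) (softSymbolCompl L M β μ (klFlowFrameU L M β U μ (n + 1)) n j')) Qm k k' else 0) -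
        klMemberArrayF L M β U μ n (softSymbolCompl L M β μ (klFlowFrameU L M β U μ n) n j') Qm) x y‖ ≤ η₂ x y) ∧
        (∀ c, ‖(fun p => -(((klTransferWeight L M β μ (klFlowFrameU L M β U μ (n + 1)) n (softSymbolCompl L M β μ (klFlowFrameU L M β U μ (n + 1)) n j) Qm p -
        klTransferWeight L M β μ (klFlowFrameU L M β U μ (n + 1)) n (softSymbolCompl L M β μ (klFlowFrameU L M β U μ (n + 1)) n j') Qm p : ℝ)) : ℂ)) c -
          (-(((klTransferWeight L M β μ (klFlowFrameU L M β U μ n) n (softSymbolCompl L M β μ (klFlowFrameU L M β U μ n) n j) Qm c -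
            klTransferWeight L M β μ (klFlowFrameU L M β U μ n) n (softSymbolCompl L M β μ (klFlowFrameU L M β U μ n) n j') Qm c : ℝ)) : ℂ))‖ ≤ d c) ∧
        (∀ x y, (ηr x y + mA U * ∑ c, η₁ x c * (d c + ‖(-(((klTransferWeight L M β μ (klFlowFrameU L M β U μ n) n (softSymbolCompl L M β μ (klFlowFrameU L M β U μ n) n j) Qm c -
            klTransferWeight L M β μ (klFlowFrameU L M β U μ n) n (softSymbolCompl L M β μ (klFlowFrameU L M β U μ n) n j') Qm c : ℝ)) : ℂ))‖) + mA U * mA U * ∑ c, d c + mA U * ∑ c, ‖(-(((klTransferWeight L M β μ (klFlowFrameU L M β U μ n) n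
                    (softSymbolCompl L M β μ (klFlowFrameU L M β U μ n) n j) Qm c -
            klTransferWeight L M β μ (klFlowFrameU L M β U μ n) n (softSymbolCompl L M β μ (klFlowFrameU L M β U μ n) n j') Qm c : ℝ)) : ℂ))‖ * η₂ c y) ≤ R₀ x y) ∧
        -- a majorant `Φ` of the FUNCTION part of the reorganised analytic majorant (history 4-point rows, localisation rows, (F)(i): owners class #1 / (c) closer / k3c2-p2)
        (∀ x y, R₀ x y +
            ((klScale klE0 n - klScale klE0 (n + 1)) * (2⁻¹ * Rhd x y) + (Rl₁ x y + Rl₂ x y) +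
              mA U * ∑ c, ((klScale klE0 n - klScale klE0 (n + 1)) * (2⁻¹ * RH₁ x c + ((β * (L : ℝ) ^ 2) ^ 3)⁻¹ * (2 * (M6 * M2 * ((1024 * 15367 : ℝ) / ((klScale klE0 n - klScale klE0 (n + 1)) * ((β * (L : ℝ) ^ 2) ^ 3)⁻¹))))) + RL₁ x c) *
                (|klTransferWeight L M β μ (klFlowFrameU L M β U μ (n + 1)) (n + 1) (softSymbolCompl L M β μ (klFlowFrameU L M β U μ (n + 1)) (n + 1) j) Qm c - klTransferWeight L M β μ (klFlowFrameU L M β U μ (n + 1)) (n + 1) (softSymbolCompl L M β μ (klFlowFrameU L M β U μ (n + 1)) (n + 1) j') Qm c| +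
                  (klBubbleMaj L M β μ (klFlowFrameU L M β U μ (n + 1)) (fun k => (softSymbolCompl L M β μ (klFlowFrameU L M β U μ (n + 1)) (n + 1) j) k - (softSymbolCompl L M β μ (klFlowFrameU L M β U μ (n + 1)) (n + 1) j') k) (softSymbolCompl L M β μ (klFlowFrameU L M β U μ (n + 1)) n (n + 1)) Qm c +
                    klBubbleMaj L M β μ (klFlowFrameU L M β U μ (n + 1)) (softSymbolCompl L M β μ (klFlowFrameU L M β U μ (n + 1)) n (n + 1)) (fun k => (softSymbolCompl L M β μ (klFlowFrameU L M β U μ (n + 1)) (n + 1) j) k - (softSymbolCompl L M β μ (klFlowFrameU L M β U μ (n + 1)) (n + 1) j') k) Qm c)) +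
              mA U * ∑ c, (|klTransferWeight L M β μ (klFlowFrameU L M β U μ (n + 1)) (n + 1) (softSymbolCompl L M β μ (klFlowFrameU L M β U μ (n + 1)) (n + 1) j) Qm c - klTransferWeight L M β μ (klFlowFrameU L M β U μ (n + 1)) (n + 1) (softSymbolCompl L M β μ (klFlowFrameU L M β U μ (n + 1)) (n + 1) j') Qm c| +
                  (klBubbleMaj L M β μ (klFlowFrameU L M β U μ (n + 1)) (fun k => (softSymbolCompl L M β μ (klFlowFrameU L M β U μ (n + 1)) (n + 1) j) k - (softSymbolCompl L M β μ (klFlowFrameU L M β U μ (n + 1)) (n + 1) j') k) (softSymbolCompl L M β μ (klFlowFrameU L M β U μ (n + 1)) n (n + 1)) Qm c +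
                    klBubbleMaj L M β μ (klFlowFrameU L M β U μ (n + 1)) (softSymbolCompl L M β μ (klFlowFrameU L M β U μ (n + 1)) n (n + 1)) (fun k => (softSymbolCompl L M β μ (klFlowFrameU L M β U μ (n + 1)) (n + 1) j) k - (softSymbolCompl L M β μ (klFlowFrameU L M β U μ (n + 1)) (n + 1) j') k) Qm c)) * ((klScale klE0 n - klScale klE0 (n + 1)) * (2⁻¹ * RH₂ c y + ((β * (L : ℝ) ^ 2) ^ 3)⁻¹ * (2 * (M6 * M2 * ((1024 * 15367 : ℝ) / ((klScale klE0 n - klScale klE0 (n + 1)) * ((β * (L : ℝ) ^ 2) ^ 3)⁻¹))))) + RL₂ c y)) ≤ Φ x y) ∧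
        -- (B1) OWNERS' SHARE (φ = 1/2, cell STATUS (R243)): the dressed FUNCTION-part majorant `𝒟[Φ](k,k′)` against the frame slack of the inherited bar plus HALF of three fifths of the ROOM
        (∀ k ∈ klBall L μ 0, ∀ k' ∈ klBall L μ 0,
          Φ k k' + ∑ c, Φ k c * ρ j' Qm c * (3 / 2 * mA U) + ∑ a', 3 / 2 * mA U * ρ j Qm a' * Φ a' k' +
              ∑ a', ∑ c, 3 / 2 * mA U * ρ j Qm a' * Φ a' c * ρ j' Qm c * (3 / 2 * mA U) ≤
            θ * (((2 : ℝ) ^ (n + 2))⁻¹ * transferBarRelIdx L Gth P r β U n j' Qm k k' + 2⁻¹ * (3 / 5 *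
              (klIdxPrefactor r (n + 1) * ((P.Klam * U) ^ 2 *
              ((min (klTorusNorm L (k - k') / klScale klE0 (n + 1)) (klScale klE0 (n + 1) / klTorusNorm L (k - k')) +
                  min (klTorusNorm L (k + k' - Qm) / klScale klE0 (n + 1)) (klScale klE0 (n + 1) / klTorusNorm L (k + k' - Qm)) +
                  ((2 : ℝ) ^ n)⁻¹ + 3 * ((L : ℝ))⁻¹) * klIdxMass n j' + ((4 : ℝ) ^ (n + 1))⁻¹ * klIdxOverlap (n + 1) j') +
            ((P.Klam * |U|) ^ 3 * ((2 : ℝ) ^ n)⁻¹ + 3 * thermalBar Gth P U β (n + 1)) * klIdxMass n j'))))) ∧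
        -- (B2) EXPLICIT SIDE, direct channel: the coefficient of `min(|k−k′|/Λₙ₊₁, Λₙ₊₁/|k−k′|)` in `TT` against half of the ROOM's direct `min` slot (a SCALAR row)
        ((M4 * M4 * (if 1 ≤ n ∧ n + 2 ≤ j' then 512 / 3 * (27 / (8 * Real.pi ^ 2)) * A2s * (16 * (klScale klE0 j' / klScale klE0 n)) / Real.pi * (10 + 50 * (4 + 8 / 3 * R.Gfr 1 * U ^ 2) * β / L) * (72 * (4 + 8 / 3 * R.Gfr 1 * U ^ 2) ^ 2) else 0) + (η4 * M4 + M4 * η4) * (if n = 0 then (0 : ℝ) else 512 / 3 * (27 / (8 * Real.pi ^ 2)) * A2s * (16 / Real.pi) * (10 + 50 * (4 + 8 / 3 * R.Gfr 1 * U ^ 2) * β / L) * (16384 * (4 + 8 / 3 * R.Gfr 1 * U ^ 2) ^ 2))) ≤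
          2⁻¹ * (θ * (3 / 5 * (klIdxPrefactor r (n + 1) * ((P.Klam * U) ^ 2 * klIdxMass n j'))))) ∧
        -- (B3) EXPLICIT SIDE, crossed channel: the coefficient of `min(|k+k′−Qm|/Λₙ₊₁, Λₙ₊₁/|k+k′−Qm|)` in `TT` against half of the ROOM's crossed `min` slot (a SCALAR row)
        ((M4 * M4 * (if 1 ≤ n ∧ n + 2 ≤ j' ∧ n + 3 ≤ nScales β then 256 / 3 * (27 / (8 * Real.pi ^ 2)) * A2s * (16 * (klScale klE0 j' / klScale klE0 n)) / Real.pi * (10 + 50 * (4 + 8 / 3 * R.Gfr 1 * U ^ 2) * β / L) * (338 * (4 + 8 / 3 * R.Gfr 1 * U ^ 2) ^ 2) else 0) + (η4 * M4 + M4 * η4) * (if n = 0 then (0 : ℝ) else 256 / 3 * (27 / (8 * Real.pi ^ 2)) * A2s * (16 / Real.pi) * (10 + 50 * (4 + 8 / 3 * R.Gfr 1 * U ^ 2) * β / L) * (16384 * (4 + 8 / 3 * R.Gfr 1 * U ^ 2) ^ 2))) ≤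
          2⁻¹ * (θ * (3 / 5 * (klIdxPrefactor r (n + 1) * ((P.Klam * U) ^ 2 * klIdxMass n j'))))) ∧
        -- (B4) EXPLICIT SIDE, constant part: `TT`'s momentum-independent part against half of the ROOM's constant slots `2⁻ⁿ`, `3/L`, overlap, cubic, thermal (a SCALAR row)
        (((M4 * M4 * (if 1 ≤ n ∧ n + 2 ≤ j' then 512 / 3 * (27 / (8 * Real.pi ^ 2)) * A2s * (16 * (klScale klE0 j' / klScale klE0 n)) / Real.pi * (10 + 50 * (4 + 8 / 3 * R.Gfr 1 * U ^ 2) * β / L) * (((2 : ℝ) ^ n)⁻¹ / 4) else 2048 * klSoftMass L M β μ (klFlowFrameU L M β U μ (n + 1)) n (fun p => softSymbolCompl L M β μ (klFlowFrameU L M β U μ (n + 1)) (n + 1) j p - softSymbolCompl L M β μ (klFlowFrameU L M β U μ (n + 1)) (n + 1) j' p)) + (η4 * M4 + M4 * η4) * (if n = 0 then (2048 * 15367 : ℝ) else (2048 * 15367 : ℝ) + 512 / 3 * (27 / (8 * Real.pi ^ 2)) * A2s * (16 / Real.pi) * (10 + 50 * (4 + 8 / 3 * R.Gfr 1 * U ^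 2) * β / L) * (Real.sqrt 2 / 4 * ((2 : ℝ) ^ n)⁻¹)) + M4 * M4 * (if 1 ≤ n ∧ n + 2 ≤ j' ∧ n + 3 ≤ nScales β then 256 / 3 * (27 / (8 * Real.pi ^ 2)) * A2s * (16 * (klScale klE0 j' / klScale klE0 n)) / Real.pi * (10 + 50 * (4 + 8 / 3 * R.Gfr 1 * U ^ 2) * β / L) * (((2 : ℝ) ^ n)⁻¹ / 4) else 1024 * klSoftMass L M β μ (klFlowFrameU L M β U μ (n + 1)) n (fun p => softSymbolCompl L M β μ (klFlowFrameU L M β U μ (n + 1)) (n + 1) j p - softSymbolCompl L M β μ (klFlowFrameU L M β U μ (n + 1)) (n + 1) j' p)) + (η4 * M4 + M4 * η4) * (if n = 0 then (1024 * 15367 : ℝ) else (1024 * 15367 : ℝ) + 256 / 3 * (27 / (8 * Real.pi ^ 2)) * A2s * (16 / Real.pi) * (10 + 50 * (4 + 8 / 3 * R.Gfr 1 * U ^ 2) * β / L) * (Real.sqrt 2 / 4 * ((2 : ℝ) ^ n)⁻¹)) +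
              2 * (M6 * M2 * (if n + 2 ≤ j' then (0 : ℝ) else 1024 * klSoftMass L M β μ (klFlowFrameU L M β U μ (n + 1)) n (fun p => softSymbolCompl L M β μ (klFlowFrameU L M β U μ (n + 1)) (n + 1) j p - softSymbolCompl L M β μ (klFlowFrameU L M β U μ (n + 1)) (n + 1) j' p)) + (η6 * M2 + M6 * η2) * (1024 * 15367 : ℝ)) +
              2 * (mA U * (M4 * M4 * (if n = 0 then (2048 * 15367 : ℝ) * (4 * 61524 / Real.pi * ((4 : ℝ) ^ (j' - (n + 1)))⁻¹ * Real.pi) else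
                  (2048 * 15367 : ℝ) * (4 * 61524 / Real.pi * ((4 : ℝ) ^ (j' - (n + 1)))⁻¹) * klScale klE0 (n + 1) + 512 / 3 * ((27 / (8 * Real.pi ^ 2)) * A2s * (16 / Real.pi) * (10 + 50 * (4 + 8 / 3 * R.Gfr 1 * U ^ 2) * β / L)) * (Real.sqrt 2 / 4 * ((2 : ℝ) ^ n)⁻¹) * (4 * 61524 / Real.pi * ((4 : ℝ) ^ (j' - (n + 1)))⁻¹ * Real.pi) +
        2 * (4 * 61524 / Real.pi * ((4 : ℝ) ^ (j' - (n + 1)))⁻¹) * ((512 / 3 * ((27 / (8 * Real.pi ^ 2)) * A2s * (16 / Real.pi) * (10 + 50 * (4 + 8 / 3 * R.Gfr 1 * U ^ 2) * β / L)) * (16384 * (4 + 8 / 3 * R.Gfr 1 * U ^ 2) ^ 2) + (2048 * 15367 : ℝ) / (8 * (4 + 8 / 3 * R.Gfr 1 * U ^ 2))) * klScale klE0 (n + 1)) * Ish +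
        (512 / 3 * ((27 / (8 * Real.pi ^ 2)) * A2s * (16 / Real.pi) * (10 + 50 * (4 + 8 / 3 * R.Gfr 1 * U ^ 2) * β / L)) * (16384 * (4 + 8 / 3 * R.Gfr 1 * U ^ 2) ^ 2) + (2048 * 15367 : ℝ) / (8 * (4 + 8 / 3 * R.Gfr 1 * U ^ 2))) * klScale klE0 (n + 1) * (4 * 61524 / Real.pi * ((4 : ℝ) ^ (j' - (n + 1)))⁻¹ * Real.pi) / (klScale klE0 (n + 1) * 2 ^ Ish)) + M4 * M4 * (if n = 0 then (1024 * 15367 : ℝ) * (4 * 61524 / Real.pi * ((4 : ℝ) ^ (j' - (n + 1)))⁻¹ * Real.pi) else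
                  (1024 * 15367 : ℝ) * (4 * 61524 / Real.pi * ((4 : ℝ) ^ (j' - (n + 1)))⁻¹) * klScale klE0 (n + 1) + 256 / 3 * ((27 / (8 * Real.pi ^ 2)) * A2s * (16 / Real.pi) * (10 + 50 * (4 + 8 / 3 * R.Gfr 1 * U ^ 2) * β / L)) * (Real.sqrt 2 / 4 * ((2 : ℝ) ^ n)⁻¹) * (4 * 61524 / Real.pi * ((4 : ℝ) ^ (j' - (n + 1)))⁻¹ * Real.pi) +
        2 * (4 * 61524 / Real.pi * ((4 : ℝ) ^ (j' - (n + 1)))⁻¹) * ((256 / 3 * ((27 / (8 * Real.pi ^ 2)) * A2s * (16 / Real.pi) * (10 + 50 * (4 + 8 / 3 * R.Gfr 1 * U ^ 2) * β / L)) * (16384 * (4 + 8 / 3 * R.Gfr 1 * U ^ 2) ^ 2) + (1024 * 15367 : ℝ) / (8 * (4 + 8 / 3 * R.Gfr 1 * U ^ 2))) * klScale klE0 (n + 1)) * Ish +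
        (256 / 3 * ((27 / (8 * Real.pi ^ 2)) * A2s * (16 / Real.pi) * (10 + 50 * (4 + 8 / 3 * R.Gfr 1 * U ^ 2) * β / L)) * (16384 * (4 + 8 / 3 * R.Gfr 1 * U ^ 2) ^ 2) + (1024 * 15367 : ℝ) / (8 * (4 + 8 / 3 * R.Gfr 1 * U ^ 2))) * klScale klE0 (n + 1) * (4 * 61524 / Real.pi * ((4 : ℝ) ^ (j' - (n + 1)))⁻¹ * Real.pi) / (klScale klE0 (n + 1) * 2 ^ Ish))))) * (1 + 3 / 2 * mA U * 738288) * (1 + 3 / 2 * mA U * 738288) +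
            ((M4 * M4 * (if 1 ≤ n ∧ n + 2 ≤ j' then 512 / 3 * (27 / (8 * Real.pi ^ 2)) * A2s * (16 * (klScale klE0 j' / klScale klE0 n)) / Real.pi * (10 + 50 * (4 + 8 / 3 * R.Gfr 1 * U ^ 2) * β / L) * (72 * (4 + 8 / 3 * R.Gfr 1 * U ^ 2) ^ 2) else 0) + (η4 * M4 + M4 * η4) * (if n = 0 then (0 : ℝ) else 512 / 3 * (27 / (8 * Real.pi ^ 2)) * A2s * (16 / Real.pi) * (10 + 50 * (4 + 8 / 3 * R.Gfr 1 * U ^ 2) * β / L) * (16384 * (4 + 8 / 3 * R.Gfr 1 * U ^ 2) ^ 2))) +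
              (M4 * M4 * (if 1 ≤ n ∧ n + 2 ≤ j' ∧ n + 3 ≤ nScales β then 256 / 3 * (27 / (8 * Real.pi ^ 2)) * A2s * (16 * (klScale klE0 j' / klScale klE0 n)) / Real.pi * (10 + 50 * (4 + 8 / 3 * R.Gfr 1 * U ^ 2) * β / L) * (338 * (4 + 8 / 3 * R.Gfr 1 * U ^ 2) ^ 2) else 0) + (η4 * M4 + M4 * η4) * (if n = 0 then (0 : ℝ) else 256 / 3 * (27 / (8 * Real.pi ^ 2)) * A2s * (16 / Real.pi) * (10 + 50 * (4 + 8 / 3 * R.Gfr 1 * U ^ 2) * β / L) * (16384 * (4 + 8 / 3 * R.Gfr 1 * U ^ 2) ^ 2)))) * ((3 / 2 * mA U) * ((((n + 1 : ℕ) + 2) * (2 * 369144 / Real.pi * klScale klE0 (n + 1) * (1 + 2 * Iw) + 738288 / 2 ^ Iw)) +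
                (((n + 1 : ℕ) + 2) * (2 * 369144 / Real.pi * klScale klE0 (n + 1) * (1 + 2 * Iw) + 738288 / 2 ^ Iw))) + (3 / 2 * mA U) * (3 / 2 * mA U) * (738288 * (((n + 1 : ℕ) + 2) * (2 * 369144 / Real.pi * klScale klE0 (n + 1) * (1 + 2 * Iw) + 738288 / 2 ^ Iw))))) ≤
          2⁻¹ * (θ * (3 / 5 * (klIdxPrefactor r (n + 1) * ((P.Klam * U) ^ 2 * ((((2 : ℝ) ^ n)⁻¹ + 3 * ((L : ℝ))⁻¹) * klIdxMass n j' + ((4 : ℝ) ^ (n + 1))⁻¹ * klIdxOverlap (n + 1) j') +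
            ((P.Klam * |U|) ^ 3 * ((2 : ℝ) ^ n)⁻¹ + 3 * thermalBar Gth P U β (n + 1)) * klIdxMass n j'))))))
    (hexport : G.WF → ∀ Q : EngConsts, Q₀.IsRaiseOf Q →
      ∀ cc : ℝ, 0 < cc → cc ≤ klEngC₃6 P R →
        ∀ μ ∈ klWindowC, ∀ U : ℝ, 0 < U → U ≤ klEngU₀10 P R cc → U ≤ u Q cc →
          ∀ β : ℝ, klBetaMin ≤ β → β ≤ Real.exp (cc / U ^ 2) →
            ∀ (L M : ℕ) [NeZero L] [NeZero M], klEngL₄ P R β U ≤ L → klEngM₃ β U L ≤ M →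
              ∀ n : ℕ, n ≤ nScales β + 1 → IsKLRegime U cc (-((n : ℕ) : ℤ)) →
                HistP klPredsV17F2 L M G P Q R β U μ 0 (n) →
                  FrameOK R U (nScales β) μ (klFlowFrameU L M β U μ (n)) →
                    (∀ j ≤ n, LevelsUExportMixedAt L M (klCU2 P R Q₀) P β U μ j) →
      ∀ j' : ℕ, n ≤ j' → j' ≤ nScales β + 1 → ∀ Qm : TorusSite 2 L, C L Qm n →
        ∀ x y, ‖klMemberArrayF L M β U μ n (softSymbolCompl L M β μ (klFlowFrameU L M β U μ n) n j') Qm x y‖ ≤ mA U) :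
    G.WF → ∀ Q : EngConsts, Q₀.IsRaiseOf Q →
    ∀ cc : ℝ, 0 < cc → cc ≤ klEngC₃6 P R →
      ∀ μ ∈ klWindowC, ∀ U : ℝ, 0 < U → U ≤ klEngU₀10 P R cc → U ≤ u Q cc →
        ∀ β : ℝ, klBetaMin ≤ β → β ≤ Real.exp (cc / U ^ 2) →
          ∀ (L M : ℕ) [NeZero L] [NeZero M], klEngL₄ P R β U ≤ L → klEngM₃ β U L ≤ M →
            ∀ n : ℕ, n ≤ nScales β + 1 → IsKLRegime U cc (-(n : ℤ)) →
              HistP klPredsV17F2 L M G P Q R β U μ 0 n →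
                FrameOK R U (nScales β) μ (klFlowFrameU L M β U μ n) →
                  (∀ j ≤ n, LevelsUExportMixedAt L M (klCU2 P R Q₀) P β U μ j) →
                    ∀ m m' : ℕ, n ≤ m' → m' ≤ m → m ≤ nScales β + 1 → ∀ Qm : TorusSite 2 L, C L Qm n →
    ∃ N : Matrix (TorusSite 2 L) (TorusSite 2 L) ℂ,
      (1 - diagonal (fun p => ((klTransferWeight L M β μ (klFlowFrameU L M β U μ n) n (softSymbolCompl L M β μ (klFlowFrameU L M β U μ n) n m) Qm p -
          klTransferWeight L M β μ (klFlowFrameU L M β U μ n) n (softSymbolCompl L M β μ (klFlowFrameU L M β U μ n) n m') Qm p : ℝ) : ℂ)) * klMemberArrayF L M β U μ n (softSymbolCompl L M β μ (klFlowFrameU L M β U μ n) n m') Qm) * N = 1 ∧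
      N * (1 - diagonal (fun p => ((klTransferWeight L M β μ (klFlowFrameU L M β U μ n) n (softSymbolCompl L M β μ (klFlowFrameU L M β U μ n) n m) Qm p -
          klTransferWeight L M β μ (klFlowFrameU L M β U μ n) n (softSymbolCompl L M β μ (klFlowFrameU L M β U μ n) n m') Qm p : ℝ) : ℂ)) * klMemberArrayF L M β U μ n (softSymbolCompl L M β μ (klFlowFrameU L M β U μ n) n m') Qm) = 1 ∧
      ∀ k ∈ klBall L μ 0, ∀ k' ∈ klBall L μ 0,
        ‖klMemberArrayF L M β U μ n (softSymbolCompl L M β μ (klFlowFrameU L M β U μ n) n m) Qm k k' - (klMemberArrayF L M β U μ n (softSymbolCompl L M β μ (klFlowFrameU L M β U μ n) n m') Qm * N) k k'‖ ≤ transferBarRelIdx L Gth P r β U n m' Qm k k' := by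
  refine pairTransferStep7_of_analytic_resolved_budgetGrid_all C hC mA hR hCF hKl hr hθ0 hθ h0 hmA h2s hA2s hkit hbase ?_ hexport
  intro hG Q hQ cc hcc0 hcc μ hμ U hU hU10 hUu β hβ hβc L M iL iM hL hM n hn hreg hhist hK hlev
  obtain ⟨hZ, hstep⟩ := hsucc hG Q hQ cc hcc0 hcc μ hμ U hU hU10 hUu β hβ hβc L M hL hM n hn hreg hhist hK hlev
  refine ⟨hZ, fun A A' b b' a ρ V V6 Sg Hd Φ Wd Br hA hA' hb hb' ha hρ hV hV6 hSg hHd hΦ hWd hBr j j' h1 h2 h3 Qm hQm => ?_⟩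
  obtain ⟨ηr, η₁, η₂, R₀, Φf, d, M4, M6, M2, η4, η6, η2, Ish, Iw, RH₁, RH₂, Rhd, RL₁, RL₂, Rl₁, Rl₂, Ng,
    hA₁, hA₂, hN0, hN, hB4, hB6, hB2, hE4, hE6, hE2, hRH₁, hRH₂, hRhd, hRL₁, hRL₂, hRl₁, hRl₂, hH, hηr, hη₁, hη₂, hd, hR₀, hΦf, hS1, hS2, hS3, hS4⟩ :=
    hstep A A' b b' a ρ V V6 Sg Hd Φ Wd Br hA hA' hb hb' ha hρ hV hV6 hSg hHd hΦ hWd hBr j j' h1 h2 h3 Qm hQm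
  refine ⟨ηr, η₁, η₂, R₀, Φf, d, M4, M6, M2, η4, η6, η2, Ish, Iw, RH₁, RH₂, Rhd, RL₁, RL₂, Rl₁, Rl₂, Ng,
    hA₁, hA₂, hN0, hN, hB4, hB6, hB2, hE4, hE6, hE2, hRH₁, hRH₂, hRhd, hRL₁, hRL₂, hRl₁, hRl₂, hH, hηr, hη₁, hη₂, hd, hR₀, hΦf, fun k hk k' hk' => ?_⟩
  -- the old budget row = (B1) + (B2)·min_d + (B3)·min_x + (B4), the two `min` profiles being nonnegative
  have hΛ : ∀ i : ℕ, 0 ≤ klScale klE0 i := fun i => by unfold klScale klE0; positivity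
  have hmd : 0 ≤ min (klTorusNorm L (k - k') / klScale klE0 (n + 1)) (klScale klE0 (n + 1) / klTorusNorm L (k - k')) :=
    le_min (div_nonneg (torusSupNorm_nonneg _) (hΛ _)) (div_nonneg (hΛ _) (torusSupNorm_nonneg _))
  have hmx : 0 ≤ min (klTorusNorm L (k + k' - Qm) / klScale klE0 (n + 1)) (klScale klE0 (n + 1) / klTorusNorm L (k + k' - Qm)) :=
    le_min (div_nonneg (torusSupNorm_nonneg _) (hΛ _)) (div_nonneg (hΛ _) (torusSupNorm_nonneg _))
  have h := add_le_add (add_le_add (add_le_add (hS1 k hk k' hk') (mul_le_mul_of_nonneg_right hS2 hmd)) (mul_le_mul_of_nonneg_right hS3 hmx)) hS4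
  exact Eq.trans_le (by ring) (h.trans_eq (by ring))

end ProducerAll

end Summit.HubbardSuperconductivity.HubbardSuperconductivity.Theorems.KLRegimeSplit

end
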